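import Mathlib
import HarnessLib
import Summits.HubbardSuperconductivity.HubbardSuperconductivity.Theorems.KLProgrammeKLRegimeEngineTowerBookkeepingProfileTok
import Summits.HubbardSuperconductivity.HubbardSuperconductivity.Theorems.KLProgrammeKLRegimeEngineTowerInstProfileLevRateFBase

/-!
# Route `KLProgramme` — crux K3 ENGINE (stmt-HubbardSuperconductivity-20437 `KLRegimeEngineV17F2`), stub (b) v2, THE LEVELS PACKAGE (ℓ):
# «(ℓ)-Z-THREAD», model layers M1/M2 — THE RE-BASED FLOOR-KEYED LAW FROM NAMED INPUTS / WITH THE BRIDGE DISCHARGED, CARRYING A TOKEN ALONG THE BLOCKS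
# (located item #18 «(Z)-EXPORT», pen (R87); cell gate-hubbard-kl, seat hubbard-kl-k3c3-p2 g16; token-passing twins of …TowerLevLawBase §3 (p4 g18 / k3c3-p2 g14)
#  and …TowerInstProfileLevRateFBase §3 (k3c2-p3 g12); the originals are untouched)

WHY.  The block step of the (ℓ) tower needs `Z^K_{Λ_{dk}} ≠ 0` at its own input scale, and that fact is the induction's own invariant (it propagates by
…TowerLevZUnitOfKitGuard under the very guard the induction hands to the step).  The generic induction carrying an abstract token is
`towerBorn_le_law_tracks_of_profile_base_tok` (…TowerBookkeepingProfileTok); this file threads the token through the first two model layers of the floor-keyed chain: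

* **`klTowerBLevF_le_law_of_inputs_base_tok`** — `klTowerBLevF_le_law_of_inputs_base` with `{Zk : ℕ → Prop}`, `hZ1 : Zk 1`,
  `hZsucc : ∀ k, 1 ≤ k → k < K_b → Zk k → Φ·towerV D τ (W·Z^m·klTowerMuLevF … d k m) < 1 → Zk (k+1)`, the step's extra premise `Zk k`, and `3 ≤ D`;
  conclusion `(∀ k, 1 ≤ k → k ≤ K_b → Zk k) ∧ (the law at every block 2 ≤ k ≤ K_b)`;
* **`klTowerBLevF_le_law_of_base_rows_tok`** — `klTowerBLevF_le_law_of_base_rows` (bridge `hR` discharged by k3c2-p3's `klTowerMuLevF_le_profileR_base`) with the same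
  three token binders inserted before the step and the same enlarged conclusion.
Every other binder is byte-identical to the original; the proofs are the originals' with the token passed through.
Compositions of landed theorems and real algebra; nothing about the model is asserted beyond them; nothing asserts (ℓ), any stub, K3 or superconductivity.
References: BGM 2006 §2.8 (2.83), (2.93)–(2.98), §3 (3.2)–(3.8) [cite: BenfattoGiulianiMastropietro2006].
-/

noncomputable section

namespace Summit.HubbardSuperconductivity.HubbardSuperconductivity.Theorems.EngineV8

set_option linter.dupNamespace false -- summit = problem name (single-conjunct summit), D-0017

open Classical
open Real Finset Literature.MathematicalPhysics.QuantumLattice Literature.Probability.LatticeModels GrassmannAlgebra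
open Literature.MathematicalPhysics.QuantumLattice.FermiRG
open Summit.HubbardSuperconductivity.HubbardSuperconductivity.Theorems.KLProgrammeLegKernels
open Summit.HubbardSuperconductivity.HubbardSuperconductivity.Theorems.KLRegimeSplit
open Summit.HubbardSuperconductivity.HubbardSuperconductivity.Theorems.KLRegimeWick
open Summit.HubbardSuperconductivity.HubbardSuperconductivity.Theorems.TorusFourierL2
open Summit.HubbardSuperconductivity.HubbardSuperconductivity.Theorems.DispersionFlow
open Summit.HubbardSuperconductivity.HubbardSuperconductivity.Theorems.PerturbedFermiCurve

variable {L M : ℕ} [NeZero L] [NeZero M]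

/-! ## §1 M1: the re-based floor-keyed law from named inputs, token carried -/

omit [NeZero L] [NeZero M] in
/-- **THE RE-BASED LEVELLED TOWER LAW FROM NAMED INPUTS, FLOOR-KEYED, CARRYING A TOKEN ALONG THE BLOCKS** («(ℓ)-Z-THREAD» twin of
`klTowerBLevF_le_law_of_inputs_base`, …TowerLevLawBase §3): the same named inputs, plus an abstract token `Zk : ℕ → Prop` with `Zk 1` at the base block and
`Zk k → guard_k → Zk (k+1)` under the step's own guard; the step at block `k` may use `Zk k`.  Conclusion: `Zk k` at every block `1 ≤ k ≤ K_b` AND the law at every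
block `2 ≤ k ≤ K_b`.  (Model: `Zk k := Z^K_{Λ_{dk}} ≠ 0`, `hZsucc` := …TowerLevZUnitOfKitGuard.) [cite: BenfattoGiulianiMastropietro2006, §2.8 (2.83), (2.93)-(2.98)] -/
theorem klTowerBLevF_le_law_of_inputs_base_tok {L M : ℕ} [NeZero L] [NeZero M] {β : ℝ} (hβ : 0 < β) (U μ : ℝ) (K : TrigPolyC4v)
    (d Kb D : ℕ) {A lam Q W Z A' Q' σ Φ ψ τ ι₁ ι₂ ι₃ : ℝ} {Zk : ℕ → Prop} (hD3 : 3 ≤ D)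
    (hA : 0 ≤ A) (hlam : 0 < lam) (hQ : 0 ≤ Q) (hW : 0 ≤ W) (hZ : 0 ≤ Z) (hA'0 : 0 ≤ A') (hQ'0 : 0 < Q')
    (hσ : 0 ≤ σ) (hΦ : 0 ≤ Φ) (hψ : 0 ≤ ψ) (hτ : 0 < τ)
    -- the base profile at block 1
    (hbase : ∀ m, 4 ≤ m → m ≤ D → W * Z ^ m * klTowerMuLevF L M β U μ K d 1 m ≤ A' * lam ^ (m - 1) * Q' ^ m)
    (hbase3 : 3 ≤ D → W * Z ^ 3 * klTowerMuLevF L M β U μ K d 1 3 ≤ ι₃ * lam ^ 2)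
    -- the re-based re-measurement bridge at blocks k ≥ 2
    (hR : ∀ k, 2 ≤ k → k < Kb →
      (∀ k', 2 ≤ k' → k' ≤ k → ∀ t : Fin 5, ∀ p, 3 ≤ p → p ≤ D → klTowerBLevF L M β U μ K d t k' p ≤ A * lam ^ (p - 1) * Q ^ p) →
      (∀ m, 4 ≤ m → m ≤ D → W * Z ^ m * klTowerMuLevF L M β U μ K d k m ≤ A' * lam ^ (m - 1) * Q' ^ m) ∧
        (3 ≤ D → W * Z ^ 3 * klTowerMuLevF L M β U μ K d k 3 ≤ ι₃ * lam ^ 2))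
    -- the imports at blocks k ≥ 1
    (hι₁ : ∀ k, 1 ≤ k → k < Kb → W * Z ^ 1 * klTowerMuLevF L M β U μ K d k 1 ≤ ι₁ * lam)
    (hι₂ : ∀ k, 1 ≤ k → k < Kb → W * Z ^ 2 * klTowerMuLevF L M β U μ K d k 2 ≤ ι₂ * lam)
    -- the token along the blocks («(ℓ)-Z-THREAD»): base, and propagation under the step's guard
    (hZ1 : Zk 1)
    (hZsucc : ∀ k, 1 ≤ k → k < Kb → Zk k → Φ * towerV D τ (fun m => W * Z ^ m * klTowerMuLevF L M β U μ K d k m) < 1 → Zk (k + 1))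
    -- the floor-keyed step at blocks k ≥ 1 («(I1)-LEV-FLOOR» LINK), which may use the token at its own block
    (hstep : ∀ t : Fin 5, ∀ k, 1 ≤ k → k < Kb → Zk k → ∀ N : ℕ, 2 ≤ N → ∀ p, 3 ≤ p → p ≤ D →
      Φ * towerV D τ (fun m => W * Z ^ m * klTowerMuLevF L M β U μ K d k m) < 1 →
      klTowerBLevF L M β U μ K d t (k + 1) p ≤
        towerFO D σ (fun m => W * Z ^ m * klTowerMuLevF L M β U μ K d k m) p +
          ∑ n ∈ Icc 2 N, exp 1 * Φ ^ (n - 1) * ψ ^ p * towerS D τ (fun m => W * Z ^ m * klTowerMuLevF L M β U μ K d k m) n p +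
          ψ ^ p * exp 1 * towerV D τ (fun m => W * Z ^ m * klTowerMuLevF L M β U μ K d k m) *
            (Φ * towerV D τ (fun m => W * Z ^ m * klTowerMuLevF L M β U μ K d k m)) ^ N /
            (1 - Φ * towerV D τ (fun m => W * Z ^ m * klTowerMuLevF L M β U μ K d k m)))
    -- the kit's numerics
    (hx₁ : 4 * σ * lam * Q' < 1) (hx₂ : 2 * lam * τ * Q' ≤ 1) (hx₃ : exp 1 * τ * lam * Q' < 1)
    (hy : Φ * (τ * (ι₁ * lam + ι₂ / (2 * Q') + ι₃ / (4 * Q' ^ 2) + A' * Q' / 4)) < 1)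
    (hθ : Φ * (exp 1 * τ * (ι₁ * lam) + (exp 1 * τ) ^ 2 * (ι₂ * lam) + (exp 1 * τ) ^ 3 * (ι₃ * lam ^ 2) +
      A' * (exp 1 * τ * Q') * ((exp 1 * τ * lam * Q') ^ 3 / (1 - exp 1 * τ * lam * Q'))) < 1)
    (hu₁ : 4 * Q' ≤ Q) (hu₂ : 2 * τ * ψ * Q' ≤ Q)
    (hclose : A' * (4 * Q') ^ 3 * (4 * σ * lam * Q' / (1 - 4 * σ * lam * Q')) +
      exp 1 * ψ * (2 * τ * ψ * Q') ^ 2 * (τ * (ι₁ * lam + ι₂ / (2 * Q') + ι₃ / (4 * Q' ^ 2) + A' * Q' / 4)) *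
        (Φ * (τ * (ι₁ * lam + ι₂ / (2 * Q') + ι₃ / (4 * Q' ^ 2) + A' * Q' / 4)) /
          (1 - Φ * (τ * (ι₁ * lam + ι₂ / (2 * Q') + ι₃ / (4 * Q' ^ 2) + A' * Q' / 4)))) ≤ A * Q ^ 3) :
    (∀ k, 1 ≤ k → k ≤ Kb → Zk k) ∧
    ∀ k, 2 ≤ k → k ≤ Kb → ∀ (t : Fin 5) (p : ℕ), 3 ≤ p → p ≤ D →
      klTowerBLevF L M β U μ K d t k p ≤ A * lam ^ (p - 1) * Q ^ p := by
  have hWZ : ∀ m : ℕ, 0 ≤ W * Z ^ m := fun m => by positivity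
  refine towerBorn_le_law_tracks_of_profile_base_tok (T := Fin 5) (K := Kb) (D := D)
    (b := fun t k p => klTowerBLevF L M β U μ K d t k p) (μ := fun k m => W * Z ^ m * klTowerMuLevF L M β U μ K d k m)
    (A := A) (lam := lam) (Q := Q) (A' := A') (Q' := Q') (ι₃ := ι₃) (Zk := Zk) hD3 hlam hA hQ hσ hΦ hψ hτ hQ'0 hA'0
    (fun k _ m => mul_nonneg (hWZ m) (klTowerMuLevF_nonneg hβ U μ K d k m)) hZ1 hZsucc ?_ ?_ hι₁ hι₂ hstep hx₁ hx₂ hx₃ hy hθ hu₁ hu₂ hclose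
  · intro k hk1 hkK ih m hm hmD
    rcases Nat.lt_or_ge k 2 with hk | hk
    · obtain rfl : k = 1 := by omega
      exact hbase m hm hmD
    · exact (hR k hk hkK ih).1 m hm hmD
  · intro k hk1 hkK hD3 ih
    rcases Nat.lt_or_ge k 2 with hk | hk
    · obtain rfl : k = 1 := by omega
      exact hbase3 hD3
    · exact (hR k hk hkK ih).2 hD3

/-! ## §2 M2: the bridge discharged, token carried -/

omit [NeZero L] [NeZero M] in
/-- **THE RE-BASED LEVELLED TOWER LAW, BRIDGE DISCHARGED, CARRYING A TOKEN ALONG THE BLOCKS** («(ℓ)-Z-THREAD» twin of `klTowerBLevF_le_law_of_base_rows`,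
…TowerInstProfileLevRateFBase §3; every binder byte-identical, plus the token `Zk : ℕ → Prop`, `Zk 1`, its propagation under the step's guard, and the step's
extra premise `Zk k`); conclusion: `Zk k` at every block `1 ≤ k ≤ K_b` AND the law at every block `2 ≤ k ≤ K_b`. [cite: BenfattoGiulianiMastropietro2006, §2.8 (2.83), (2.93)-(2.98)] -/
theorem klTowerBLevF_le_law_of_base_rows_tok :
    ∃ C₁ C₂ : ℝ, 0 < C₁ ∧ 0 < C₂ ∧ ∀ R : RenConsts, R.WF2 → ∃ c₃' : ℝ, 0 < c₃' ∧ ∃ U₀' : ℝ, 0 < U₀' ∧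
      ∀ (P : SplitConsts) (c : ℝ), P.WF → 0 < c → c ≤ klEngC₃6 P R → c ≤ c₃' →
      ∀ μ ∈ klWindowC, ∀ U : ℝ, 0 < U → U ≤ klEngU₀9 P R c → U ≤ U₀' → ∀ β : ℝ, klBetaMin ≤ β → β ≤ Real.exp (c / U ^ 2) →
      ∀ K : TrigPolyC4v, FrameOK R U (nScales β) μ K → ∀ (L M : ℕ) [NeZero L] [NeZero M],
      klEngL₃ β U ≤ L → klEngM₃ β U L ≤ M → ∀ d Kb D : ℕ, 2 ≤ d → d * Kb - 1 ≤ nScales β + 1 → 3 ≤ D →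
      ∀ (A lam Q Ab Qb : ℝ), 0 ≤ A → 0 < lam → 0 < Q → 0 ≤ Ab → 0 ≤ Qb →
      -- the base datum at the family `F_{d−1}` and its unit law (k3c2-p3 «(ℓ)-BASE-LEV» p668143 / p670020 from p3's grid step)
      ∀ Nb : Fin 5 → ℕ → ℝ, (∀ t p, 0 ≤ Nb t p) →
        (∀ (t : Fin 5) (p : ℕ) (Ωe' : Fin (2 * p) → Option (SectorLeg (sectorCount (d - 1)))), levelCount Ωe' = (t : ℕ) + 1 →
          klLevNormOf L M β μ K (d - 1) (2 * p) (klTowerInput L M β U μ K d 1) Ωe' ≤ Nb t p) →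
        (∀ (t : Fin 5) (p : ℕ), 3 ≤ p → Nb t p / klLevUnitF β M t p (d - 1) ≤ Ab * lam ^ (p - 1) * Qb ^ p) →
      ∀ (W Z A' Q' : ℝ), 0 < W → 0 < Z →
        W * ((27 : ℝ) ^ 5 * (C₁ / C₂) * (8 : ℝ) ^ (d - 1) * (Ab + A / (1 - ((2 : ℝ) ^ d)⁻¹))) ≤ A' →
        Z * (C₂ ^ 2 * ((2 : ℝ) ^ (d - 1))⁻¹ * max Q Qb) ≤ Q' → 0 < Q' →
      ∀ (σ Φ ψ τ ι₁ ι₂ ι₃ X : ℝ), 0 ≤ σ → 0 ≤ Φ → 0 ≤ ψ → 0 < τ → W * Z ^ 3 * X ≤ ι₃ → A' * Q' ^ 3 ≤ ι₃ →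
      -- the block-1 profile (named)
      (∀ m, 4 ≤ m → m ≤ D → W * Z ^ m * klTowerMuLevF L M β U μ K d 1 m ≤ A' * lam ^ (m - 1) * Q' ^ m) →
      (3 ≤ D → W * Z ^ 3 * klTowerMuLevF L M β U μ K d 1 3 ≤ ι₃ * lam ^ 2) →
      -- the imports (E1 (I4))
      (∀ k, 1 ≤ k → k < Kb → W * Z ^ 1 * klTowerMuLevF L M β U μ K d k 1 ≤ ι₁ * lam) →
      (∀ k, 1 ≤ k → k < Kb → W * Z ^ 2 * klTowerMuLevF L M β U μ K d k 2 ≤ ι₂ * lam) →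
      -- the located six-leg cell «(I2)-F1-HMU» at the blocks `k ≥ 2`
      (∀ k, 2 ≤ k → k < Kb → klTowerMuLevAtF L M β U μ K d 0 k 3 ≤ X * lam ^ 2) →
      -- the token along the blocks («(ℓ)-Z-THREAD»): base, and propagation under the step's guard
      ∀ Zk : ℕ → Prop, Zk 1 →
      (∀ k, 1 ≤ k → k < Kb → Zk k → Φ * towerV D τ (fun m => W * Z ^ m * klTowerMuLevF L M β U μ K d k m) < 1 → Zk (k + 1)) →
      -- the step at blocks `k ≥ 1`, which may use the token at its own block
      (∀ t : Fin 5, ∀ k, 1 ≤ k → k < Kb → Zk k → ∀ N : ℕ, 2 ≤ N → ∀ p, 3 ≤ p → p ≤ D →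
        Φ * towerV D τ (fun m => W * Z ^ m * klTowerMuLevF L M β U μ K d k m) < 1 →
        klTowerBLevF L M β U μ K d t (k + 1) p ≤
          towerFO D σ (fun m => W * Z ^ m * klTowerMuLevF L M β U μ K d k m) p +
            ∑ n ∈ Icc 2 N, exp 1 * Φ ^ (n - 1) * ψ ^ p * towerS D τ (fun m => W * Z ^ m * klTowerMuLevF L M β U μ K d k m) n p +
            ψ ^ p * exp 1 * towerV D τ (fun m => W * Z ^ m * klTowerMuLevF L M β U μ K d k m) *
              (Φ * towerV D τ (fun m => W * Z ^ m * klTowerMuLevF L M β U μ K d k m)) ^ N /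
              (1 - Φ * towerV D τ (fun m => W * Z ^ m * klTowerMuLevF L M β U μ K d k m))) →
      -- the kit's numerics (E1 (I5))
      4 * σ * lam * Q' < 1 → 2 * lam * τ * Q' ≤ 1 → exp 1 * τ * lam * Q' < 1 →
      Φ * (τ * (ι₁ * lam + ι₂ / (2 * Q') + ι₃ / (4 * Q' ^ 2) + A' * Q' / 4)) < 1 →
      Φ * (exp 1 * τ * (ι₁ * lam) + (exp 1 * τ) ^ 2 * (ι₂ * lam) + (exp 1 * τ) ^ 3 * (ι₃ * lam ^ 2) +
        A' * (exp 1 * τ * Q') * ((exp 1 * τ * lam * Q') ^ 3 / (1 - exp 1 * τ * lam * Q'))) < 1 →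
      4 * Q' ≤ Q → 2 * τ * ψ * Q' ≤ Q →
      A' * (4 * Q') ^ 3 * (4 * σ * lam * Q' / (1 - 4 * σ * lam * Q')) +
        exp 1 * ψ * (2 * τ * ψ * Q') ^ 2 * (τ * (ι₁ * lam + ι₂ / (2 * Q') + ι₃ / (4 * Q' ^ 2) + A' * Q' / 4)) *
          (Φ * (τ * (ι₁ * lam + ι₂ / (2 * Q') + ι₃ / (4 * Q' ^ 2) + A' * Q' / 4)) /
            (1 - Φ * (τ * (ι₁ * lam + ι₂ / (2 * Q') + ι₃ / (4 * Q' ^ 2) + A' * Q' / 4)))) ≤ A * Q ^ 3 →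
      (∀ k, 1 ≤ k → k ≤ Kb → Zk k) ∧
      ∀ k, 2 ≤ k → k ≤ Kb → ∀ (t : Fin 5) (p : ℕ), 3 ≤ p → p ≤ D →
        klTowerBLevF L M β U μ K d t k p ≤ A * lam ^ (p - 1) * Q ^ p := by
  obtain ⟨C₁, C₂, hC₁, hC₂, h⟩ := klTowerMuLevF_le_profileR_base
  refine ⟨C₁, C₂, hC₁, hC₂, fun R hR2 => ?_⟩
  obtain ⟨c₃, hc₃, U₀, hU₀, h'⟩ := h R hR2
  refine ⟨c₃, hc₃, U₀, hU₀, ?_⟩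
  intro P c hP hc hc6 hc₃' μ hμ U hU hU9 hU₀' β hβmin hβc K hK L M _ _ hL3 hM3 d Kb D hd hKbN hD A lam Q Ab Qb hA hlam hQ hAb hQb
    Nb hNb0 hcar hlawb W Z A' Q' hW hZ hA'1 hQ'1 hQ'0 σ Φ ψ τ ι₁ ι₂ ι₃ X hσ hΦ hψ hτ hXι hAQι hbase hbase3 hι₁ hι₂ hcell Zk hZ1 hZsucc hstep
    hx₁ hx₂ hx₃ hy hθ hu₁ hu₂ hclose
  have hβ : 0 < β := KLRegimeSplit.pos_of_klBetaMin_le hβmin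
  -- the profile constants of the base `R` rows and their domination by `A′, Q′`
  set AR : ℝ := (27 : ℝ) ^ 5 * (C₁ / C₂) * (8 : ℝ) ^ (d - 1) * (Ab + A / (1 - ((2 : ℝ) ^ d)⁻¹)) with hAR
  set QR : ℝ := C₂ ^ 2 * ((2 : ℝ) ^ (d - 1))⁻¹ * max Q Qb with hQR
  have hρ1 : ((2 : ℝ) ^ d)⁻¹ < 1 := inv_lt_one_of_one_lt₀ (one_lt_pow₀ (by norm_num) (by omega))
  have hAR0 : 0 ≤ AR := by
    have : 0 ≤ A / (1 - ((2 : ℝ) ^ d)⁻¹) := div_nonneg hA (sub_nonneg.2 hρ1.le)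
    positivity
  have hQR0 : 0 ≤ QR := by
    have : 0 ≤ max Q Qb := le_max_of_le_left hQ.le
    positivity
  have hA'0 : 0 ≤ A' := le_trans (by positivity) hA'1
  have hdom : ∀ m : ℕ, W * Z ^ m * (AR * lam ^ (m - 1) * QR ^ m) ≤ A' * lam ^ (m - 1) * Q' ^ m := fun m => by
    rw [show W * Z ^ m * (AR * lam ^ (m - 1) * QR ^ m) = W * AR * lam ^ (m - 1) * (Z * QR) ^ m by rw [mul_pow]; ring]
    exact mul_le_mul (mul_le_mul_of_nonneg_right hA'1 (pow_nonneg hlam.le _)) (pow_le_pow_left₀ (by positivity) hQ'1 m)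
      (pow_nonneg (by positivity) _) (by positivity)
  have hWZ : ∀ m : ℕ, 0 ≤ W * Z ^ m := fun m => by positivity
  have hkN : ∀ k, k < Kb → d * k - 1 ≤ nScales β + 1 := fun k hk =>
    le_trans (Nat.sub_le_sub_right (Nat.mul_le_mul_left d hk.le) 1) hKbN
  refine klTowerBLevF_le_law_of_inputs_base_tok hβ U μ K d Kb D hD hA hlam hQ.le hW.le hZ.le hA'0 hQ'0 hσ hΦ hψ hτ hbase hbase3 ?_
    hι₁ hι₂ hZ1 hZsucc hstep hx₁ hx₂ hx₃ hy hθ hu₁ hu₂ hclose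
  -- the bridge `hR` at the blocks `k ≥ 2`, from the re-based `R` rows
  intro k hk2 hkK ih
  have hrow := h' P c hP hc hc6 hc₃' μ hμ U hU hU9 hU₀' β hβmin hβc K hK L M hL3 hM3 d k hd hk2 (hkN k hkK) D A lam Q Ab Qb hA hlam.le hQ.le hAb hQb
    Nb hNb0 hcar hlawb ih
  refine ⟨fun m hm hmD => (mul_le_mul_of_nonneg_left (hrow.1 m hm hmD) (hWZ m)).trans (hdom m), fun hD3 => ?_⟩
  refine (mul_le_mul_of_nonneg_left (hrow.2 (X * lam ^ 2) hD3 (hcell k hk2 hkK)) (hWZ 3)).trans ?_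
  rw [mul_max_of_nonneg _ _ (hWZ 3)]
  refine max_le ?_ ?_
  · calc W * Z ^ 3 * (X * lam ^ 2) = W * Z ^ 3 * X * lam ^ 2 := by ring
      _ ≤ ι₃ * lam ^ 2 := mul_le_mul_of_nonneg_right hXι (sq_nonneg _)
  · calc W * Z ^ 3 * (AR * lam ^ 2 * QR ^ 3) = W * Z ^ 3 * (AR * lam ^ (3 - 1) * QR ^ 3) := by norm_num
      _ ≤ A' * lam ^ (3 - 1) * Q' ^ 3 := hdom 3
      _ = A' * Q' ^ 3 * lam ^ 2 := by ring
      _ ≤ ι₃ * lam ^ 2 := mul_le_mul_of_nonneg_right hAQι (sq_nonneg _)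

end Summit.HubbardSuperconductivity.HubbardSuperconductivity.Theorems.EngineV8

end
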